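import Literature.NumberTheory.Sieve.PrimeGapLimitPointsOfPoisson
import Literature.NumberTheory.Sieve.LinearEquationsInPrimesDimOne
import Literature.NumberTheory.Sieve.LinearEquationsInPrimesMultiplicativity
import Literature.NumberTheory.Sieve.LinearEquationsInPrimesCountDeduction
import HarnessLib

/-!
# The generalised Hardy–Littlewood conjecture implies `[0, ∞) ⊆ 𝓛` (limit points of normalized
# prime gaps), via Gallagher's theorem

Green–Tao's Conjecture 1.2 (`GeneralizedHardyLittlewood`, file `LinearEquationsInPrimes.lean`, the
second conjunct of the `Parity` summit) contains, as the case `d = 1` of SHIFT SYSTEMS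
`n ↦ (n + d₁, …, n + d_r)` on the convex body `K = [1, N]`, the Hardy–Littlewood prime `r`-tuple
asymptotic with von Mangoldt weights, UNIFORMLY over all distinct shifts `1 ≤ dᵢ ≤ N` (the size
`‖Ψ‖_N = r + ∑ᵢ dᵢ/N ≤ 2r` is bounded) [cite: GreenTao2010, Conj. 1.2 and Def. 1.1].  This is (more
than) the "uniform version of the prime `r`-tuple conjecture" under which Gallagher proved the Poisson
law for primes in intervals `(n, n + λ log N]` [cite: Gallagher1976, Theorem 1], whence every
`t ≥ 0` is a limit point of `(p_{n+1} − p_n)/log p_n` (Erdős's conjecture `𝓛 = [0, ∞]` on its finite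
part; Merikoski, §1).  This file PROVES the chain inside the tree:

* §1 shift systems as Green–Tao data (`shiftSystem`, non-degeneracy for distinct shifts, size `≤ 2r`)
  — as in parity-ideate-p4's HOME sketch `uniformShiftHL_of_ghl` (Sketch4.lean, 2026-08-28), here
  re-proved;
* §2 the dictionary: `vonMangoldtSum (shiftSystem t) [1,N] = ∑_{n ≤ N} ∏ⱼ Λ(n + tⱼ)`,
  `archFactor = N − 1`, `localFactor (shiftSystem t) p = singularSeriesFactor (tupleSet t) p`, hence
  `singularProduct (shiftSystem t) = singularSeries (tupleSet t) = 𝔖(t)` (both are ordered limits of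
  the same partial products) [cite: GreenTao2010, (1.2)–(1.7)];
* §3 the de-weighting `Λ → primes` is the tree theorem
  `generalizedHardyLittlewood_count_of_vonMangoldt_holds` (Conj. 1.2 ⇒ Conj. 1.4, Green–Tao's sketch
  after (1.8)); for shift systems it reads `|π_t(N) − (N−1)𝔖(t)/logʳ N| ≤ ε((N−1)𝔖(t) + N)/logʳ N`
  uniformly in `t` (`orderedTupleCount_shift_uniform`), and summing over the `≤ hʳ` ordered tuples of
  distinct shifts in `[1, h(N)]` with Gallagher's average `h^{−r} ∑_t 𝔖(t) → 1`
  (`Gallagher.tendsto_sum_singularSeries_div_pow`) gives the averaged moments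
  `N⁻¹ ∑_t π_t(N) → λʳ` for `h(N)/log N → λ` (`moments_of_GHL`), feeding
  `Gallagher.Gallagher1976_theorem1_of_moments` (`poisson_of_GHL`) and
  `Gallagher.Ici_subset_primeGapLimitSet_of_poisson`;
* `Ici_subset_primeGapLimitSet_of_GHL : GeneralizedHardyLittlewood → Set.Ici 0 ⊆ primeGapLimitSet`.

Everything here is PROVED; no new facts; the only hypothesis is the summit conjunct
`GeneralizedHardyLittlewood` itself (per-tuple RELATIVE precision is not available uniformly — `𝔖(t)` is
unbounded over shift tuples — which is why the moments are averaged over `t` before taking limits, as in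
Gallagher's paper).

## References

* P. X. Gallagher, *On the distribution of primes in short intervals*, Mathematika 23 (1976) 4–9,
  Theorem 1 and eq. (3). [Gallagher1976]
* B. Green, T. Tao, *Linear equations in primes*, Ann. of Math. 171 (2010) 1753–1850, Def. 1.1,
  (1.1)–(1.8), Conj. 1.2, Conj. 1.4. [GreenTao2010]
* J. Merikoski, *Limit points of normalized prime gaps*, J. Lond. Math. Soc. 102 (2020), §1.
  [Merikoski2020GapLimitPoints]
-/

noncomputable section

open Filter Finset Real MeasureTheory
open scoped Topology ArithmeticFunction.vonMangoldt

namespace Literature.NumberTheory.Sieve.Gallagher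

open Literature.NumberTheory.Sieve.GPY (distinctTuples mem_distinctTuples card_distinctTuples_le)

/-! ### §1 Shift systems -/

/-- The shift system `n ↦ (n + t₀, …, n + t_{r−1})` on `ℤ¹` (`d = 1`, `t` forms `ψⱼ = ⟨(1), tⱼ⟩`).
[cite: GreenTao2010, Def. 1.1] -/
def shiftSystem {r : ℕ} (t : Fin r → ℤ) : Fin r → AffLinForm 1 := fun j => ⟨![1], t j⟩

/-- `ψⱼ(n) = n₀ + tⱼ`. [cite: GreenTao2010, Def. 1.1] -/
theorem shiftSystem_eval {r : ℕ} (t : Fin r → ℤ) (j : Fin r) (n : Fin 1 → ℤ) :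
    (shiftSystem t j).eval n = n 0 + t j := by
  simp [shiftSystem, AffLinForm.eval]

/-- Distinct shifts give a system satisfying Green–Tao's standing hypotheses (no constant form, no two
forms rationally proportional) — a system of infinite complexity. [cite: GreenTao2010, Def. 1.1] -/
theorem isNondegenerateSystem_shiftSystem {r : ℕ} {t : Fin r → ℤ} (hinj : Function.Injective t) :
    IsNondegenerateSystem (shiftSystem t) := by
  refine ⟨fun i hc => ?_, fun i j hij a b hab => ?_⟩
  · have := congrFun hc 0
    simp [shiftSystem] at this
  · have h0 := hab (fun _ => 0)
    have h1 := hab (fun _ => 1)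
    simp only [shiftSystem_eval, zero_add] at h0 h1
    have hab' : a = b := by linear_combination h1 - h0
    have hprod : a * (t i - t j) = 0 := by linear_combination h0 - (t j) * hab'
    rcases mul_eq_zero.mp hprod with ha | hh
    · exact ⟨ha, hab' ▸ ha⟩
    · exact absurd (hinj (sub_eq_zero.mp hh)) hij

/-- `‖Ψ‖_N = r + ∑ⱼ |tⱼ|/N ≤ 2r` when `|tⱼ| ≤ N`. [cite: GreenTao2010, (1.1)] -/
theorem affLinSize_shiftSystem_le {r : ℕ} (t : Fin r → ℤ) (N : ℕ) (hN : ∀ j, |t j| ≤ (N : ℤ)) :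
    affLinSize (shiftSystem t) N ≤ ((2 * r : ℕ) : ℝ) := by
  unfold affLinSize
  have h1 : ∀ i : Fin r, ∑ j : Fin 1, |(((shiftSystem t i).coeff j : ℤ) : ℝ)| = 1 := by
    intro i
    simp [shiftSystem]
  have h2 : ∀ i : Fin r, |(((shiftSystem t i).const : ℤ) : ℝ) / N| ≤ 1 := by
    intro i
    simp only [shiftSystem]
    rcases Nat.eq_zero_or_pos N with hN0 | hNpos
    · subst hN0
      simp
    · rw [abs_div, Nat.abs_cast, div_le_one (by exact_mod_cast hNpos)]
      exact_mod_cast hN i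
  calc ∑ i, ∑ j, |(((shiftSystem t i).coeff j : ℤ) : ℝ)| +
        ∑ i, |(((shiftSystem t i).const : ℤ) : ℝ) / N|
      ≤ ∑ _i : Fin r, (1 : ℝ) + ∑ _i : Fin r, (1 : ℝ) :=
        add_le_add (sum_le_sum fun i _ => (h1 i).le) (sum_le_sum fun i _ => h2 i)
    _ = ((2 * r : ℕ) : ℝ) := by
        simp only [sum_const, card_univ, Fintype.card_fin, nsmul_eq_mul, mul_one]
        push_cast
        ring

/-! ### §2 The dictionary between Green–Tao's data and the classical tuple objects -/

/-- The convex body `K = [1, N] ⊂ ℝ¹`. [cite: GreenTao2010, Conj. 1.2] -/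
def natBox (N : ℕ) : Set (Fin 1 → ℝ) := {x | 1 ≤ x 0 ∧ x 0 ≤ N}

/-- `[1, N]` is convex. [folklore] -/
private theorem convex_natBox (N : ℕ) : Convex ℝ (natBox N) := by
  have : natBox N = (fun x : Fin 1 → ℝ => x 0) ⁻¹' Set.Icc (1 : ℝ) N := by
    ext x; simp [natBox, Set.mem_Icc]
  rw [this]
  exact (convex_Icc _ _).linear_preimage (LinearMap.proj 0)

/-- `[1, N] ⊆ [−N, N]`. [folklore] -/
private theorem natBox_subset_realBox (N : ℕ) : natBox N ⊆ realBox 1 N := by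
  intro x hx
  simp only [natBox, Set.mem_setOf_eq] at hx
  simp only [realBox, Set.mem_Icc]
  constructor <;> intro j <;> rw [Fin.fin_one_eq_zero j]
  · have : (0 : ℝ) ≤ N := Nat.cast_nonneg N
    linarith [hx.1]
  · exact hx.2

/-- The shift system of a tuple of natural numbers. [folklore] -/
private theorem shiftSystem_natCast_eval {r : ℕ} (t : Fin r → ℕ) (j : Fin r) (m : ℕ) :
    (shiftSystem (fun j => (t j : ℤ)) j).eval (fun _ => (m : ℤ)) = ((m + t j : ℕ) : ℤ) := by
  rw [shiftSystem_eval]; push_cast; ring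

/-- **`∑_{n ∈ K ∩ ℤ} ∏ⱼ Λ(ψⱼ(n))` for the shift system on `K = [1, N]` is `∑_{n=1}^{N} ∏ⱼ Λ(n + tⱼ)`.**
[cite: GreenTao2010, (1.2)] -/
theorem vonMangoldtSum_shiftSystem {r : ℕ} (t : Fin r → ℕ) (N : ℕ) :
    vonMangoldtSum (shiftSystem fun j => (t j : ℤ)) (natBox N) N =
      ∑ n ∈ Icc 1 N, ∏ j, (Λ (n + t j) : ℝ) := by
  classical
  unfold vonMangoldtSum
  symm
  refine Finset.sum_nbij' (fun m => fun _ : Fin 1 => (m : ℤ)) (fun n => (n 0).toNat) ?_ ?_ ?_ ?_ ?_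
  · intro m hm
    rw [mem_Icc] at hm
    simp only [mem_filter, latticeBox, Fintype.mem_piFinset, mem_Icc, realPoint, natBox,
      Set.mem_setOf_eq, Int.cast_natCast]
    refine ⟨fun _ => ⟨by omega, by exact_mod_cast hm.2⟩, by exact_mod_cast hm.1, by exact_mod_cast hm.2⟩
  · intro n hn
    simp only [mem_filter, natBox, Set.mem_setOf_eq, realPoint] at hn
    obtain ⟨-, h1, h2⟩ := hn
    have h1' : (1 : ℤ) ≤ n 0 := by exact_mod_cast h1
    have h2' : n 0 ≤ (N : ℤ) := by exact_mod_cast h2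
    rw [mem_Icc]; omega
  · intro m hm; simp
  · intro n hn
    simp only [mem_filter, natBox, Set.mem_setOf_eq, realPoint] at hn
    have h1' : (1 : ℤ) ≤ n 0 := by exact_mod_cast hn.2.1
    funext j
    simp only [Fin.fin_one_eq_zero j]
    exact Int.toNat_of_nonneg (by omega)
  · intro m hm
    refine prod_congr rfl fun j _ => ?_
    rw [shiftSystem_natCast_eval, intVonMangoldt, Int.toNat_natCast]

/-- **`β_∞ = N − 1`** for the shift system of non-negative shifts on `K = [1, N]` (`N ≥ 1`): every
`ψⱼ(x) = x + tⱼ` is positive on `K`, so `β_∞ = vol [1, N]`. [cite: GreenTao2010, (1.4)] -/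
theorem archFactor_shiftSystem {r : ℕ} (t : Fin r → ℕ) {N : ℕ} (hN : 1 ≤ N) :
    archFactor (shiftSystem fun j => (t j : ℤ)) (natBox N) = (N : ℝ) - 1 := by
  rw [DimOne.archFactor_eq]
  have hset : {x : ℝ | (fun _ : Fin 1 => x) ∈ natBox N ∧
      ∀ i, 0 < (shiftSystem (fun j => (t j : ℤ)) i).realEval (fun _ => x)} = Set.Icc (1 : ℝ) N := by
    ext x
    simp only [natBox, Set.mem_setOf_eq, Set.mem_Icc, DimOne.realEval_eq, shiftSystem,
      Matrix.cons_val_zero, Int.cast_one, one_mul, Int.cast_natCast]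
    constructor
    · rintro ⟨⟨h1, h2⟩, -⟩; exact ⟨h1, h2⟩
    · rintro ⟨h1, h2⟩
      refine ⟨⟨h1, h2⟩, fun i => ?_⟩
      have : (0 : ℝ) ≤ t i := Nat.cast_nonneg _
      linarith
  rw [hset, Real.volume_Icc, ENNReal.toReal_ofReal]
  have : (1 : ℝ) ≤ N := by exact_mod_cast hN
  linarith

/-- `ν_p` of the tuple equals the number of classes `−tⱼ (mod p)`. [folklore] -/
private theorem card_image_neg_eq {r : ℕ} (t : Fin r → ℕ) (p : ℕ) :
    #(univ.image fun j : Fin r => -((t j : ℕ) : ZMod p)) = tupleResidueCount (tupleSet t) p := by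
  classical
  unfold tupleResidueCount tupleSet
  rw [image_image]
  have : (fun j : Fin r => -((t j : ℕ) : ZMod p)) =
      (fun x : ZMod p => -x) ∘ fun j => ((t j : ℕ) : ZMod p) := rfl
  rw [this, ← image_image, card_image_of_injective _ neg_injective]
  congr 1
  ext x
  simp

/-- The good residues `x mod p` (no `x + tⱼ ≡ 0`) correspond to the points `v ∈ (ℤ/p)¹` off the
classes `−tⱼ`. [folklore] -/
private theorem card_filter_good_eq {r : ℕ} (t : Fin r → ℕ) (p : ℕ) [NeZero p]
    [DecidablePred fun v : Fin 1 → ZMod p => ∀ i, v 0 + ((t i : ℕ) : ZMod p) ≠ 0] :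
    #(univ.filter fun v : Fin 1 → ZMod p => ∀ i, v 0 + ((t i : ℕ) : ZMod p) ≠ 0) =
      #(univ \ univ.image fun j : Fin r => -((t j : ℕ) : ZMod p)) := by
  classical
  refine card_nbij' (fun v => v 0) (fun x _ => x) (fun v hv => ?_) (fun x hx => ?_) (fun v _ => ?_)
    (fun x _ => rfl)
  · simp only [mem_coe, mem_filter, mem_univ, true_and] at hv
    simp only [mem_coe, Finset.mem_sdiff, mem_univ, true_and, mem_image, not_exists]
    intro j hj
    exact hv j (by rw [← hj]; ring)
  · simp only [mem_coe, Finset.mem_sdiff, mem_univ, true_and, mem_image, not_exists] at hx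
    simp only [mem_coe, mem_filter, mem_univ, true_and]
    intro i hi
    exact hx i ((eq_neg_iff_add_eq_zero.mpr hi).symm)
  · funext i
    simp [Fin.fin_one_eq_zero i]

/-- **The local factors agree:** `β_p(shift system of t) = (1 − ν_p(t)/p)(1 − 1/p)^{−r}`, the Euler
factor of the Hardy–Littlewood singular series, for every prime `p` and injective `t`.
[cite: GreenTao2010, (1.6)] -/
theorem localFactor_shiftSystem {r : ℕ} {t : Fin r → ℕ} (hinj : Function.Injective t) {p : ℕ}
    (hp : p.Prime) :
    Sieve.localFactor (shiftSystem fun j => (t j : ℤ)) p = singularSeriesFactor (tupleSet t) p := by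
  classical
  haveI : Fact p.Prime := ⟨hp⟩
  haveI : NeZero p := ⟨hp.ne_zero⟩
  have hp0 : (p : ℝ) ≠ 0 := by exact_mod_cast hp.ne_zero
  have hp1 : (p : ℝ) - 1 ≠ 0 := by
    have : (1 : ℝ) < p := by exact_mod_cast hp.one_lt
    linarith
  have hφ : (Nat.totient p : ℝ) = p - 1 := by
    rw [Nat.totient_prime hp, Nat.cast_sub hp.one_lt.le, Nat.cast_one]
  rw [localFactor_eq_sum_zmod]
  -- the integrand: `(p/(p-1))^r` if no `v₀ + tⱼ` vanishes, else `0`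
  have hterm : ∀ (v : Fin 1 → ZMod p) (i : Fin r),
      localVonMangoldtZMod p ((shiftSystem (fun j => (t j : ℤ)) i).modEval p v) =
        if v 0 + ((t i : ℕ) : ZMod p) ≠ 0 then (p : ℝ) / (p - 1) else 0 := by
    intro v i
    have hev : (shiftSystem (fun j => (t j : ℤ)) i).modEval p v = v 0 + ((t i : ℕ) : ZMod p) := by
      simp [AffLinForm.modEval, shiftSystem]
    rw [hev]
    by_cases hv : v 0 + ((t i : ℕ) : ZMod p) = 0
    · simp [localVonMangoldtZMod, hv]
    · simp [localVonMangoldtZMod, hv, isUnit_iff_ne_zero, hφ]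
  have hint : ∀ v : Fin 1 → ZMod p,
      ∏ i, localVonMangoldtZMod p ((shiftSystem (fun j => (t j : ℤ)) i).modEval p v) =
        if ∀ i, v 0 + ((t i : ℕ) : ZMod p) ≠ 0 then ((p : ℝ) / (p - 1)) ^ r else 0 := by
    intro v
    simp_rw [hterm v]
    rw [Fintype.prod_ite_zero]
    split_ifs <;> simp [div_pow]
  simp_rw [hint]
  rw [← sum_filter, sum_const, nsmul_eq_mul, card_filter_good_eq, card_univ_sdiff, ZMod.card,
    card_image_neg_eq]
  -- algebra
  have hν : tupleResidueCount (tupleSet t) p ≤ p := by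
    unfold tupleResidueCount
    exact (card_le_univ _).trans (ZMod.card p).le
  have hcard : (tupleSet t).card = r := by
    have hinj' : Function.Injective fun j : Fin r => (t j : ℤ) := fun a b h => by
      dsimp only at h
      exact hinj (by exact_mod_cast h)
    unfold tupleSet
    rw [card_image_of_injective _ hinj']
    simp
  rw [singularSeriesFactor, hcard, Nat.cast_sub hν, pow_one, one_sub_div hp0, one_sub_div hp0, inv_div]
  ring

/-- **The singular product of the shift system is the Hardy–Littlewood singular series** `𝔖(t)`
(both are the ordered limits of the same partial products over `p ≤ x`).
[cite: GreenTao2010, (1.7)] -/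
theorem singularProduct_shiftSystem {r : ℕ} {t : Fin r → ℕ} (hinj : Function.Injective t) :
    singularProduct (shiftSystem fun j => (t j : ℤ)) = singularSeries (tupleSet t) := by
  unfold singularProduct singularSeries
  congr 1
  funext x
  unfold singularProductPartial singularSeriesPartial
  exact prod_congr rfl fun p hp => localFactor_shiftSystem hinj (Nat.mem_primesLE.1 hp).2

/-- **Conjecture 1.2 for shift systems, in classical dress.**  `GeneralizedHardyLittlewood` gives, for
each `r ≥ 1` and `ε > 0`, an `N₀` such that for all `N ≥ N₀` and ALL injective `t` with
`1 ≤ tⱼ ≤ N`: `|∑_{n=1}^{N} ∏ⱼ Λ(n + tⱼ) − (N − 1) 𝔖(t)| ≤ ε N`.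
[cite: GreenTao2010, Conj. 1.2] -/
theorem vonMangoldt_shift_uniform (hS : GeneralizedHardyLittlewood) {r : ℕ} (hr : 1 ≤ r) {ε : ℝ}
    (hε : 0 < ε) :
    ∃ N₀ : ℕ, ∀ N : ℕ, N₀ ≤ N → ∀ t : Fin r → ℕ, Function.Injective t → (∀ j, 1 ≤ t j ∧ t j ≤ N) →
      |∑ n ∈ Icc 1 N, ∏ j, (Λ (n + t j) : ℝ) - ((N : ℝ) - 1) * singularSeries (tupleSet t)| ≤ ε * N := by
  obtain ⟨N₀, hN₀⟩ := hS 1 r (2 * r) le_rfl hr ε hε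
  refine ⟨max N₀ 1, fun N hN t hinj ht => ?_⟩
  have hN0 : N₀ ≤ N := le_trans (le_max_left _ _) hN
  have hN1 : 1 ≤ N := le_trans (le_max_right _ _) hN
  have hinj' : Function.Injective fun j => (t j : ℤ) := Nat.cast_injective.comp hinj
  have hsize : affLinSize (shiftSystem fun j => (t j : ℤ)) N ≤ ((2 * r : ℕ) : ℝ) :=
    affLinSize_shiftSystem_le _ N fun j => by
      rw [Nat.abs_cast]; exact_mod_cast (ht j).2
  have := hN₀ N hN0 (shiftSystem fun j => (t j : ℤ)) (isNondegenerateSystem_shiftSystem hinj') hsize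
    (natBox N) (convex_natBox N) (natBox_subset_realBox N)
  rwa [vonMangoldtSum_shiftSystem, archFactor_shiftSystem t hN1, singularProduct_shiftSystem hinj,
    pow_one] at this

/-! ### §3 From Conjecture 1.4 (counting form; a tree consequence of Conjecture 1.2) to Gallagher's
averaged moments, the Poisson law, and `[0, ∞) ⊆ 𝓛` -/

/-- **`#{n ∈ K ∩ ℤ : ψⱼ(n) prime ∀ j}` for the shift system on `K = [1, N]` is Gallagher's ordered tuple
count `π_t(N) = #{n ≤ N : n + tⱼ all prime}`.** [cite: GreenTao2010, (1.8)] -/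
theorem primePointCount_shiftSystem {r : ℕ} (t : Fin r → ℕ) (N : ℕ) :
    primePointCount (shiftSystem fun j => (t j : ℤ)) (natBox N) N = orderedTupleCount t N := by
  classical
  unfold primePointCount orderedTupleCount
  symm
  refine Finset.card_nbij' (fun m => fun _ : Fin 1 => (m : ℤ)) (fun n => (n 0).toNat) ?_ ?_ ?_ ?_
  · intro m hm
    rw [mem_coe, mem_filter, mem_Icc] at hm
    simp only [mem_coe, mem_filter, latticeBox, Fintype.mem_piFinset, mem_Icc, realPoint, natBox,
      Set.mem_setOf_eq, Int.cast_natCast, shiftSystem_natCast_eval, Int.toNat_natCast]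
    exact ⟨fun _ => ⟨by omega, by exact_mod_cast hm.1.2⟩,
      ⟨by exact_mod_cast hm.1.1, by exact_mod_cast hm.1.2⟩, hm.2⟩
  · intro n hn
    rw [mem_coe, mem_filter] at hn
    simp only [natBox, Set.mem_setOf_eq, realPoint] at hn
    obtain ⟨-, ⟨h1, h2⟩, hpr⟩ := hn
    have h1' : (1 : ℤ) ≤ n 0 := by exact_mod_cast h1
    have h2' : n 0 ≤ (N : ℤ) := by exact_mod_cast h2
    obtain ⟨k, hk⟩ : ∃ k : ℕ, n 0 = k := ⟨(n 0).toNat, (Int.toNat_of_nonneg (by omega)).symm⟩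
    rw [hk] at h1' h2'
    simp only [mem_coe, mem_filter, mem_Icc, hk, Int.toNat_natCast]
    refine ⟨⟨by omega, by omega⟩, fun j => ?_⟩
    have := hpr j
    rwa [shiftSystem_eval, hk, ← Nat.cast_add, Int.toNat_natCast] at this
  · intro m hm
    simp
  · intro n hn
    rw [mem_coe, mem_filter] at hn
    simp only [natBox, Set.mem_setOf_eq, realPoint] at hn
    have h1' : (1 : ℤ) ≤ n 0 := by exact_mod_cast hn.2.1.1
    funext j
    simp only [Fin.fin_one_eq_zero j]
    exact Int.toNat_of_nonneg (by omega)

/-- **Conjecture 1.4 for shift systems, in classical dress.**  Under `GeneralizedHardyLittlewood`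
(hence, by the tree theorem `generalizedHardyLittlewood_count_of_vonMangoldt_holds`, under its counting
form, Green–Tao's Conjecture 1.4): for each `r ≥ 1` and `ε > 0` there is `N₀` such that for all
`N ≥ N₀` and ALL injective `t` with `1 ≤ tⱼ ≤ N`,
`|π_t(N) − (N − 1) 𝔖(t) / logʳ N| ≤ ε ((N − 1) 𝔖(t) + N) / logʳ N`.
[cite: GreenTao2010, Conj. 1.4] -/
theorem orderedTupleCount_shift_uniform (hS : GeneralizedHardyLittlewood) {r : ℕ} (hr : 1 ≤ r)
    {ε : ℝ} (hε : 0 < ε) :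
    ∃ N₀ : ℕ, ∀ N : ℕ, N₀ ≤ N → ∀ t : Fin r → ℕ, Function.Injective t → (∀ j, 1 ≤ t j ∧ t j ≤ N) →
      |(orderedTupleCount t N : ℝ) - ((N : ℝ) - 1) * singularSeries (tupleSet t) / Real.log N ^ r| ≤
        ε * (((N : ℝ) - 1) * singularSeries (tupleSet t) + N) / Real.log N ^ r := by
  obtain ⟨N₀, hN₀⟩ :=
    generalizedHardyLittlewood_count_of_vonMangoldt_holds hS 1 r (2 * r) le_rfl hr ε hε
  refine ⟨max N₀ 1, fun N hN t hinj ht => ?_⟩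
  have hN0 : N₀ ≤ N := le_trans (le_max_left _ _) hN
  have hN1 : 1 ≤ N := le_trans (le_max_right _ _) hN
  have hinj' : Function.Injective fun j => (t j : ℤ) := Nat.cast_injective.comp hinj
  have hsize : affLinSize (shiftSystem fun j => (t j : ℤ)) N ≤ ((2 * r : ℕ) : ℝ) :=
    affLinSize_shiftSystem_le _ N fun j => by
      rw [Nat.abs_cast]
      exact_mod_cast (ht j).2
  have := hN₀ N hN0 (shiftSystem fun j => (t j : ℤ)) (isNondegenerateSystem_shiftSystem hinj') hsize
    (natBox N) (convex_natBox N) (natBox_subset_realBox N)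
  rwa [primePointCount_shiftSystem, archFactor_shiftSystem t hN1, singularProduct_shiftSystem hinj,
    pow_one] at this

/-- In Gallagher's regime `h(N)/log N → λ` one has `h(N) ≤ N` for all large `N` (so the shifts
`tⱼ ≤ h(N)` keep `‖Ψ_t‖_N ≤ 2r`). [folklore] -/
private theorem eventually_window_le {lam : ℝ} {h : ℕ → ℕ}
    (hh : Tendsto (fun N : ℕ => (h N : ℝ) / Real.log N) atTop (𝓝 lam)) :
    ∀ᶠ N : ℕ in atTop, h N ≤ N := by
  have hlog : Tendsto (fun N : ℕ => Real.log N / N) atTop (𝓝 0) := by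
    have := Real.tendsto_pow_log_div_mul_add_atTop 1 0 1 one_ne_zero
    simp only [pow_one, one_mul, add_zero] at this
    exact this.comp tendsto_natCast_atTop_atTop
  have hprod : Tendsto (fun N : ℕ => (h N : ℝ) / Real.log N * (Real.log N / N)) atTop
      (𝓝 (lam * 0)) := hh.mul hlog
  rw [mul_zero] at hprod
  have hev : (fun N : ℕ => (h N : ℝ) / Real.log N * (Real.log N / N)) =ᶠ[atTop]
      fun N : ℕ => (h N : ℝ) / N := by
    filter_upwards [eventually_ge_atTop 2] with N hN
    have hl : Real.log N ≠ 0 := (Real.log_pos (by exact_mod_cast hN)).ne'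
    have hN' : (N : ℝ) ≠ 0 := by exact_mod_cast (by omega : N ≠ 0)
    field_simp
  have hlim : Tendsto (fun N : ℕ => (h N : ℝ) / N) atTop (𝓝 0) := hprod.congr' hev
  filter_upwards [hlim.eventually (eventually_lt_nhds zero_lt_one), eventually_ge_atTop 1]
    with N hN hN1
  have hNpos : (0 : ℝ) < N := by exact_mod_cast hN1
  have : (h N : ℝ) < N := by rwa [div_lt_one hNpos] at hN
  exact_mod_cast this.le

/-- `∑_t 𝔖(t) / logʳ N → λʳ` for `t` over the distinct `r`-tuples in `[1, h(N)]`, `h(N)/log N → λ > 0`: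
Gallagher's (3) (`tendsto_sum_singularSeries_div_pow`: `h^{−r} ∑_t 𝔖(t) → 1`) times `(h/log N)ʳ → λʳ`.
[cite: Gallagher1976, eq. 3] -/
private theorem tendsto_sum_singularSeries_div_log_pow {lam : ℝ} (hlam : 0 < lam) {h : ℕ → ℕ}
    (hh : Tendsto (fun N : ℕ => (h N : ℝ) / Real.log N) atTop (𝓝 lam)) (r : ℕ) :
    Tendsto (fun N : ℕ =>
      (∑ t ∈ distinctTuples r (h N), singularSeries (tupleSet t)) / Real.log N ^ r) atTop
      (𝓝 (lam ^ r)) := by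
  classical
  set G : ℕ → ℝ := fun hh =>
    (∑ t ∈ distinctTuples r hh, singularSeries (tupleSet t)) / (hh : ℝ) ^ r with hG
  have hGlim : Tendsto G atTop (𝓝 1) := by
    have := tendsto_sum_singularSeries_div_pow r
    simp only [hG, distinctTuples]
    exact this
  have hhtop : Tendsto h atTop atTop := tendsto_atTop_of_div_log hlam hh
  have hratio : Tendsto (fun N : ℕ => ((h N : ℝ) / Real.log N) ^ r) atTop (𝓝 (lam ^ r)) := hh.pow r
  have hmain : Tendsto (fun N : ℕ => G (h N) * ((h N : ℝ) / Real.log N) ^ r) atTop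
      (𝓝 (lam ^ r)) := by
    have := (hGlim.comp hhtop).mul hratio
    simpa using this
  refine hmain.congr' ?_
  filter_upwards [hhtop.eventually (eventually_ge_atTop 1)] with N hhN
  have hhr : (h N : ℝ) ^ r ≠ 0 := pow_ne_zero _ (by exact_mod_cast (by omega : h N ≠ 0))
  simp only [hG]
  rw [div_pow, div_mul_div_comm, mul_comm ((h N : ℝ) ^ r) (Real.log N ^ r),
    mul_div_mul_right _ _ hhr]

/-- `(N − 1)/N → 1`. [folklore] -/
private theorem tendsto_pred_div_self :
    Tendsto (fun N : ℕ => ((N : ℝ) - 1) / N) atTop (𝓝 1) := by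
  have h1 : Tendsto (fun N : ℕ => 1 - 1 / (N : ℝ)) atTop (𝓝 (1 - 0)) :=
    tendsto_const_nhds.sub tendsto_one_div_atTop_nhds_zero_nat
  rw [sub_zero] at h1
  refine h1.congr' ?_
  filter_upwards [eventually_ge_atTop 1] with N hN
  have : (N : ℝ) ≠ 0 := by exact_mod_cast (by omega : N ≠ 0)
  field_simp

/-- Summing the counting asymptotics over the distinct `r`-tuples in `[1, h]^r` (at most `hʳ` of them,
`𝔖 ≥ 0`) and dividing by `N ≥ 2`. [folklore] -/
private theorem sum_orderedTupleCount_near {r N h : ℕ} {ε : ℝ} (hε : 0 ≤ ε) (hN : 2 ≤ N)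
    (hper : ∀ t ∈ distinctTuples r h,
      |(orderedTupleCount t N : ℝ) - ((N : ℝ) - 1) * singularSeries (tupleSet t) / Real.log N ^ r| ≤
        ε * (((N : ℝ) - 1) * singularSeries (tupleSet t) + N) / Real.log N ^ r) :
    |(∑ t ∈ distinctTuples r h, (orderedTupleCount t N : ℝ)) / N -
        ((N : ℝ) - 1) / N *
          ((∑ t ∈ distinctTuples r h, singularSeries (tupleSet t)) / Real.log N ^ r)| ≤
      ε * ((∑ t ∈ distinctTuples r h, singularSeries (tupleSet t)) / Real.log N ^ r +
        ((h : ℝ) / Real.log N) ^ r) := by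
  have hℓ : 0 < Real.log N ^ r := pow_pos (Real.log_pos (by exact_mod_cast hN)) r
  have hℓne : Real.log N ^ r ≠ 0 := hℓ.ne'
  have hS0 : 0 ≤ ∑ t ∈ distinctTuples r h, singularSeries (tupleSet t) :=
    sum_nonneg fun t _ => singularSeries_nonneg_holds _
  have hNpos : (0 : ℝ) < N := by exact_mod_cast (by omega : 0 < N)
  have hNne : (N : ℝ) ≠ 0 := hNpos.ne'
  have hN1 : ((N : ℝ) - 1) ≤ N := by linarith
  have hT : (#(distinctTuples r h) : ℝ) ≤ (h : ℝ) ^ r := by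
    exact_mod_cast card_distinctTuples_le r h
  -- step 1: the summed absolute error
  have h1 : |∑ t ∈ distinctTuples r h, (orderedTupleCount t N : ℝ) -
      ((N : ℝ) - 1) * (∑ t ∈ distinctTuples r h, singularSeries (tupleSet t)) / Real.log N ^ r| ≤
      ε * (((N : ℝ) - 1) * (∑ t ∈ distinctTuples r h, singularSeries (tupleSet t)) +
        #(distinctTuples r h) * N) / Real.log N ^ r := by
    have heq : ((N : ℝ) - 1) * (∑ t ∈ distinctTuples r h, singularSeries (tupleSet t)) /
        Real.log N ^ r =
        ∑ t ∈ distinctTuples r h, ((N : ℝ) - 1) * singularSeries (tupleSet t) / Real.log N ^ r := by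
      rw [mul_sum, sum_div]
    rw [heq, ← sum_sub_distrib]
    calc |∑ t ∈ distinctTuples r h, ((orderedTupleCount t N : ℝ) -
            ((N : ℝ) - 1) * singularSeries (tupleSet t) / Real.log N ^ r)|
        ≤ ∑ t ∈ distinctTuples r h, |(orderedTupleCount t N : ℝ) -
            ((N : ℝ) - 1) * singularSeries (tupleSet t) / Real.log N ^ r| := abs_sum_le_sum_abs _ _
      _ ≤ ∑ t ∈ distinctTuples r h,
            ε * (((N : ℝ) - 1) * singularSeries (tupleSet t) + N) / Real.log N ^ r :=
          sum_le_sum fun t ht => hper t ht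
      _ = ε * (((N : ℝ) - 1) * (∑ t ∈ distinctTuples r h, singularSeries (tupleSet t)) +
            #(distinctTuples r h) * N) / Real.log N ^ r := by
          rw [← sum_div, ← mul_sum, sum_add_distrib, ← mul_sum, sum_const, nsmul_eq_mul]
  -- step 2: crude simplification of the error (`(N-1)𝔖 ≤ N 𝔖`, `#T ≤ hʳ`)
  have h2 : ε * (((N : ℝ) - 1) * (∑ t ∈ distinctTuples r h, singularSeries (tupleSet t)) +
        #(distinctTuples r h) * N) / Real.log N ^ r ≤
      N * (ε * ((∑ t ∈ distinctTuples r h, singularSeries (tupleSet t)) / Real.log N ^ r +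
        ((h : ℝ) / Real.log N) ^ r)) := by
    have hnum : ((N : ℝ) - 1) * (∑ t ∈ distinctTuples r h, singularSeries (tupleSet t)) +
        #(distinctTuples r h) * N ≤
        N * (∑ t ∈ distinctTuples r h, singularSeries (tupleSet t)) + N * (h : ℝ) ^ r := by
      nlinarith [mul_le_mul_of_nonneg_right hN1 hS0, mul_le_mul_of_nonneg_right hT hNpos.le]
    calc ε * (((N : ℝ) - 1) * (∑ t ∈ distinctTuples r h, singularSeries (tupleSet t)) +
          #(distinctTuples r h) * N) / Real.log N ^ r
        ≤ ε * (N * (∑ t ∈ distinctTuples r h, singularSeries (tupleSet t)) + N * (h : ℝ) ^ r) /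
            Real.log N ^ r := by gcongr
      _ = N * (ε * ((∑ t ∈ distinctTuples r h, singularSeries (tupleSet t)) / Real.log N ^ r +
            ((h : ℝ) / Real.log N) ^ r)) := by
          rw [div_pow]
          field_simp
  -- step 3: divide by `N`
  have heq2 : (∑ t ∈ distinctTuples r h, (orderedTupleCount t N : ℝ)) / N -
      ((N : ℝ) - 1) / N *
        ((∑ t ∈ distinctTuples r h, singularSeries (tupleSet t)) / Real.log N ^ r) =
      (∑ t ∈ distinctTuples r h, (orderedTupleCount t N : ℝ) -
        ((N : ℝ) - 1) * (∑ t ∈ distinctTuples r h, singularSeries (tupleSet t)) / Real.log N ^ r) /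
          N := by
    ring
  rw [heq2, abs_div, abs_of_pos hNpos, div_le_iff₀ hNpos]
  calc _ ≤ _ := h1
    _ ≤ _ := h2
    _ = _ := mul_comm _ _

/-- **Gallagher's averaged moments under the generalised Hardy–Littlewood conjecture.**  If
`GeneralizedHardyLittlewood` holds, `λ > 0` and `h(N)/log N → λ`, then for every `r`,
`N⁻¹ ∑_t π_t(N) → λʳ`, the sum over the ordered `r`-tuples `t` of distinct shifts in `[1, h(N)]`
(Gallagher's (1) summed with (3): main term `(1 − 1/N) ∑_t 𝔖(t)/logʳ N → λʳ`, error
`≤ ε (∑_t 𝔖(t)/logʳ N + (h/log N)ʳ)`). [cite: Gallagher1976, Theorem 1] -/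
theorem moments_of_GHL (hS : GeneralizedHardyLittlewood) {lam : ℝ} (hlam : 0 < lam) {h : ℕ → ℕ}
    (hh : Tendsto (fun N : ℕ => (h N : ℝ) / Real.log N) atTop (𝓝 lam)) (r : ℕ) :
    Tendsto (fun N : ℕ => (∑ t ∈ distinctTuples r (h N), (orderedTupleCount t N : ℝ)) / N) atTop
      (𝓝 (lam ^ r)) := by
  classical
  rcases Nat.eq_zero_or_pos r with rfl | hr
  · simp_rw [sum_orderedTupleCount_zero, pow_zero]
    refine tendsto_const_nhds.congr' ?_
    filter_upwards [eventually_ge_atTop 1] with N hN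
    have : (N : ℝ) ≠ 0 := by exact_mod_cast (by omega : N ≠ 0)
    field_simp
  have hSS := tendsto_sum_singularSeries_div_log_pow hlam hh r
  have hR : Tendsto (fun N : ℕ => ((h N : ℝ) / Real.log N) ^ r) atTop (𝓝 (lam ^ r)) := hh.pow r
  have hcomp : Tendsto (fun N : ℕ => ((N : ℝ) - 1) / N *
      ((∑ t ∈ distinctTuples r (h N), singularSeries (tupleSet t)) / Real.log N ^ r)) atTop
      (𝓝 (lam ^ r)) := by
    have := tendsto_pred_div_self.mul hSS
    simpa using this
  rw [Metric.tendsto_nhds]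
  intro ε hε
  have hlr : 0 < lam ^ r + 1 := by positivity
  have h4 : (4 : ℝ) * (lam ^ r + 1) ≠ 0 := by positivity
  set ε₁ : ℝ := ε / (4 * (lam ^ r + 1)) with hε₁
  have hε₁pos : 0 < ε₁ := by positivity
  obtain ⟨N₀, hN₀⟩ := orderedTupleCount_shift_uniform hS hr hε₁pos
  filter_upwards [(Metric.tendsto_nhds.1 hcomp) (ε / 2) (by positivity),
    (Metric.tendsto_nhds.1 hR) 1 one_pos, (Metric.tendsto_nhds.1 hSS) 1 one_pos,
    eventually_window_le hh, eventually_ge_atTop (max N₀ 2)] with N hc hRN hSN hhN hN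
  have hN0 : N₀ ≤ N := le_trans (le_max_left _ _) hN
  have hN2 : 2 ≤ N := le_trans (le_max_right _ _) hN
  have hper : ∀ t ∈ distinctTuples r (h N),
      |(orderedTupleCount t N : ℝ) - ((N : ℝ) - 1) * singularSeries (tupleSet t) / Real.log N ^ r| ≤
        ε₁ * (((N : ℝ) - 1) * singularSeries (tupleSet t) + N) / Real.log N ^ r := by
    intro t ht
    rw [mem_distinctTuples] at ht
    refine hN₀ N hN0 t ht.2 fun j => ?_
    have := ht.1 j
    rw [mem_Icc] at this
    exact ⟨this.1, this.2.trans hhN⟩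
  have hsum := sum_orderedTupleCount_near hε₁pos.le hN2 hper
  rw [Real.dist_eq] at hc hRN hSN ⊢
  have hRN' : ((h N : ℝ) / Real.log N) ^ r ≤ lam ^ r + 1 := by
    rw [abs_lt] at hRN
    linarith
  have hSN' : (∑ t ∈ distinctTuples r (h N), singularSeries (tupleSet t)) / Real.log N ^ r ≤
      lam ^ r + 1 := by
    rw [abs_lt] at hSN
    linarith
  have hb : ε₁ * ((∑ t ∈ distinctTuples r (h N), singularSeries (tupleSet t)) / Real.log N ^ r +
      ((h N : ℝ) / Real.log N) ^ r) ≤ ε / 2 := by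
    calc ε₁ * ((∑ t ∈ distinctTuples r (h N), singularSeries (tupleSet t)) / Real.log N ^ r +
          ((h N : ℝ) / Real.log N) ^ r)
        ≤ ε₁ * ((lam ^ r + 1) + (lam ^ r + 1)) := by gcongr
      _ = ε / 2 := by
          rw [hε₁]
          field_simp
          ring
  calc |(∑ t ∈ distinctTuples r (h N), (orderedTupleCount t N : ℝ)) / N - lam ^ r|
      ≤ |(∑ t ∈ distinctTuples r (h N), (orderedTupleCount t N : ℝ)) / N -
          ((N : ℝ) - 1) / N *
            ((∑ t ∈ distinctTuples r (h N), singularSeries (tupleSet t)) / Real.log N ^ r)| +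
        |((N : ℝ) - 1) / N *
            ((∑ t ∈ distinctTuples r (h N), singularSeries (tupleSet t)) / Real.log N ^ r) -
          lam ^ r| := abs_sub_le _ _ _
    _ < ε / 2 + ε / 2 := add_lt_add_of_le_of_lt (hsum.trans hb) hc
    _ = ε := by ring

/-- **The generalised Hardy–Littlewood conjecture implies Gallagher's Poisson law** for the number of
primes in `(n, n + h]`, `h ∼ λ log N`: `P_k(h, N)/N → e^{−λ} λᵏ/k!` for every `k`
(`Gallagher1976_theorem1_of_moments` fed with `moments_of_GHL`). [cite: Gallagher1976, Theorem 1] -/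
theorem poisson_of_GHL (hS : GeneralizedHardyLittlewood) {lam : ℝ} (hlam : 0 < lam) {h : ℕ → ℕ}
    (hh : Tendsto (fun N : ℕ => (h N : ℝ) / Real.log N) atTop (𝓝 lam)) (k : ℕ) :
    Tendsto (fun N : ℕ => (exactCount k (h N) N : ℝ) / N) atTop
      (𝓝 (Real.exp (-lam) * lam ^ k / k.factorial)) :=
  Gallagher1976_theorem1_of_moments (moments_of_GHL hS hlam hh) k

/-- **`GeneralizedHardyLittlewood → [0, ∞) ⊆ 𝓛`:** under Green–Tao's Conjecture 1.2 every `β ≥ 0` is a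
limit point of the normalized prime gaps `(p_{n+1} − p_n)/log p_n` (Gallagher's theorem, case `k = 0`,
and `Ici_subset_primeGapLimitSet_of_poisson`); `∞ ∈ 𝓛` (Westzynthius) is unconditional and not part of
`primeGapLimitSet ⊆ ℝ`. [cite: Merikoski2020GapLimitPoints, Section 1] -/
theorem Ici_subset_primeGapLimitSet_of_GHL (hS : GeneralizedHardyLittlewood) :
    Set.Ici (0 : ℝ) ⊆ primeGapLimitSet :=
  Ici_subset_primeGapLimitSet_of_poisson fun s hs g hg => by
    simpa using poisson_of_GHL hS hs hg 0


end Literature.NumberTheory.Sieve.Gallagher
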